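import Mathlib
import HarnessLib
import Summits.Ventures.LatticeQCDFlow.Scoring.RegenerativeMedianOfGroupsSigma
import Summits.Ventures.LatticeQCDFlow.Scoring.IndepMHRetrospectiveCoinsSup
import Summits.Ventures.LatticeQCDFlow.Scoring.FlowSamplerAutocorrelation

/-!
# The exact flow sampler on `SU(n)^E` carries an IMPLEMENTABLE regenerative protocol: retrospective
# coins at rate `e^{−2δ}`, the tour estimator's error bar at the CLT scale, and exponential
# median-of-groups confidence — UNCONDITIONAL, from any start

HONEST FRAMING: exact (Metropolis-corrected) sampling algorithms for lattice gauge theory;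
figures of merit are autocorrelation/cost numbers at stated couplings and volumes; no
continuum-physics claim.

Venture `LatticeQCDFlow` (cell pub-lqcd), topic `Scoring`; FANOUT row 8 (`s0-cpn-nemc`, GEN-17).
NEW WORK of the cell, not a published result; no definition is introduced.  The `SU(n)^E` instance
of GEN-17's regenerative chapter, composed with the tree's exact flow-MCMC theorem
`Exactness.flowSampler_exact_doeblin` (UNCONDITIONAL: a uniform defect `δ` of Lüscher's flow equation
gives a weight `w = dπ/dq ∈ [e^{−2δ}, e^{2δ}]`, exactness of `K = indepMH q w` for
`π = 𝒵⁻¹ e^{−S} D[U]`, and Doeblin `K(U, ·) ≥ e^{−2δ} π`).  By `Scoring/IndepMHRetrospectiveCoinsSup.lean`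
the coin-augmented flow-MCMC step — propose `V ∼ q` (push a Haar configuration through the flow),
accept with probability `min(1, w V / w U)`, on acceptance flip heads with probability
`e^{−2δ} max(w U, w V)`, on rejection tails — IS a split kernel of `(K, π, e^{−2δ})`; hence
(`Scoring/RegenerativeEstimatorSigma.lean`, `Scoring/RegenerativeMedianOfGroupsSigma.lean`) the tours
between heads give, from ANY initial configuration law: `P(s ≤ |Â_R − π(f)|) ≤
4(e^{−2δ} σ²_f/s² + 1 − e^{−2δ})/R` with `σ²_f` the Green–Kubo asymptotic variance of `f` under `K`,
and `P(#{bad groups among K} ≥ K/2) ≤ e^{−K/8}` once `4(e^{−2δ} σ²_f/s² + 1 − e^{−2δ})/m ≤ 1/4`.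
Printed counterpart NAMED ONLY: Mykland–Tierney–Yu 1995 §4.1 (regeneration for independence
chains) — nothing is cited as a fact; no flow paper states a regenerative error bar.

## Content (hypotheses of `Scoring.flowSampler_autocorrelation` with `δ > 0`; `π = 𝒵⁻¹e^{−S}D[U]`)

* **`flowSampler_regenerative`** — `∃ w` (the weight), `∃` the Doeblin bound, `∃ κ̂` a Markov kernel
  on `SU(n)^E × Bool` equal to the coin-augmented flow-MCMC step, such that for all bounded
  measurable `f`, all initial laws, `R ≥ 1`, `s > 0`: the CLT-scale tour-estimator bound, and for
  `m ≥ 1` under the group-size condition, the `e^{−K/8}` median-of-groups bound for every `K`.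

NOT CLAIMED: any value of `δ`; optimal constants; a CLT; the cost of evaluating `w` (it needs the
flow's Jacobian — the same quantity the accept/reject step already uses).
-/

noncomputable section

namespace Summit.Ventures.LatticeQCDFlow.Scoring

open MeasureTheory ProbabilityTheory Filter Finset Summit.Ventures.LatticeQCDFlow.Exactness
open Literature.MathematicalPhysics.QuantumFieldTheory
open Literature.MathematicalPhysics.QuantumFieldTheory.Luscher2010
open Summit.Ventures.LatticeQCDFlow.TrivializingMaps
open Literature.Probability.MarkovChains
open scoped ENNReal Matrix Matrix.Norms.Frobenius ContDiff

variable {d L n : ℕ} [NeZero L]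

/-- **THE EXACT FLOW SAMPLER'S IMPLEMENTABLE REGENERATIVE PROTOCOL — UNCONDITIONAL, any start.**
See the module docstring. -/
theorem flowSampler_regenerative (B : SuBasis n)
    {S : AmbConfig d L n → ℝ} (hS : ContDiff ℝ ∞ S) {F : ℝ → AmbConfig d L n → ℝ}
    (hF : ContDiff ℝ ∞ fun p : ℝ × AmbConfig d L n => F p.1 p.2)
    {Φ : ℝ → GaugeConfig d L (Matrix.specialUnitaryGroup (Fin n) ℂ) →
      GaugeConfig d L (Matrix.specialUnitaryGroup (Fin n) ℂ)}
    (hΦ : IsFlowMap (fun t W => -linkGrad B (F t) W) Φ) {c : ℝ → ℝ} {δ : ℝ} (hδ0 : 0 < δ)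
    (hδ : ∀ t ∈ Set.Icc (0 : ℝ) 1, ∀ U : GaugeConfig d L (Matrix.specialUnitaryGroup (Fin n) ℂ),
      |luscherL B S t (F t) (WilsonFlow.coeConfig U) - S (WilsonFlow.coeConfig U) - c t| ≤ δ)
    (q : Measure (GaugeConfig d L (Matrix.specialUnitaryGroup (Fin n) ℂ))) [IsProbabilityMeasure q]
    (hq : q = Measure.map (Φ 1) (trivialMeasure (Matrix.specialUnitaryGroup (Fin n) ℂ) d L)) :
    ∃ w : GaugeConfig d L (Matrix.specialUnitaryGroup (Fin n) ℂ) → ℝ, ∃ hw : Measurable w,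
      ∃ hd : (∀ (U : GaugeConfig d L (Matrix.specialUnitaryGroup (Fin n) ℂ))
          {A : Set (GaugeConfig d L (Matrix.specialUnitaryGroup (Fin n) ℂ))}, MeasurableSet A →
          ENNReal.ofReal (Real.exp (-(2 * δ))) *
            boltzmannMeasure (fun U : GaugeConfig d L (Matrix.specialUnitaryGroup (Fin n) ℂ) =>
              S (WilsonFlow.coeConfig U)) A ≤ indepMH q w U A),
      (q.withDensity fun U => ENNReal.ofReal (w U)) =
        boltzmannMeasure (fun U : GaugeConfig d L (Matrix.specialUnitaryGroup (Fin n) ℂ) =>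
          S (WilsonFlow.coeConfig U)) ∧
      Kernel.Invariant (indepMH q w)
        (boltzmannMeasure fun U : GaugeConfig d L (Matrix.specialUnitaryGroup (Fin n) ℂ) =>
          S (WilsonFlow.coeConfig U)) ∧
      haveI : Fact (Measurable w) := ⟨hw⟩
      ∃ κs : Kernel (GaugeConfig d L (Matrix.specialUnitaryGroup (Fin n) ℂ) × Bool)
          (GaugeConfig d L (Matrix.specialUnitaryGroup (Fin n) ℂ) × Bool), ∃ _ : IsMarkovKernel κs,
        -- `κ̂` IS the coin-augmented flow-MCMC step …
        (∀ p, κs p = (q.withDensity (fun V => imhAcceptE w p.1 V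
            * ENNReal.ofReal (Real.exp (-(2 * δ)) * max (w p.1) (w V)))).map (fun V => (V, true))
          + ((q.withDensity (fun V => imhAcceptE w p.1 V
              * (1 - ENNReal.ofReal (Real.exp (-(2 * δ)) * max (w p.1) (w V)))))
            + (1 - imhAcceptMass q w p.1) • Measure.dirac p.1).map (fun V => (V, false))) ∧
        -- … AND a split kernel of `(K, π, e^{−2δ})` …
        (∀ p, κs p = (ENNReal.ofReal (Real.exp (-(2 * δ)))
            • boltzmannMeasure (fun U : GaugeConfig d L (Matrix.specialUnitaryGroup (Fin n) ℂ) =>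
                S (WilsonFlow.coeConfig U))).map (fun V => (V, true))
          + ((1 - ENNReal.ofReal (Real.exp (-(2 * δ)))) • @Doeblin.residualKernel _ _ (indepMH q w) _
              (boltzmannMeasure fun U : GaugeConfig d L (Matrix.specialUnitaryGroup (Fin n) ℂ) =>
                S (WilsonFlow.coeConfig U))
              (isProbabilityMeasure_boltzmannMeasure (d := d) (L := L)
                (hS.continuous.comp WilsonFlow.continuous_coeConfig))
              (ENNReal.ofReal (Real.exp (-(2 * δ))))
              (fun U _ hA => hd U hA) p.1).map (fun V => (V, false))) ∧
        -- … so its tours certify error bars at the CLT scale, from any start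
        ∀ (μs : Measure (GaugeConfig d L (Matrix.specialUnitaryGroup (Fin n) ℂ) × Bool))
          [IsProbabilityMeasure μs]
          (f : GaugeConfig d L (Matrix.specialUnitaryGroup (Fin n) ℂ) → ℝ), Measurable f →
          ∀ C : ℝ, (∀ U, |f U| ≤ C) → ∀ R : ℕ, 0 < R → ∀ s : ℝ, 0 < s →
          let π := boltzmannMeasure fun U : GaugeConfig d L (Matrix.specialUnitaryGroup (Fin n) ℂ) =>
            S (WilsonFlow.coeConfig U)
          (Kernel.trajMeasure
              (X := fun _ : ℕ => GaugeConfig d L (Matrix.specialUnitaryGroup (Fin n) ℂ) × Bool) μs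
              (fun j : ℕ => κs.comap (fun y : (i : ↥(Finset.Iic j)) →
                  GaugeConfig d L (Matrix.specialUnitaryGroup (Fin n) ℂ) × Bool =>
                y ⟨j, Finset.mem_Iic.2 le_rfl⟩) (measurable_pi_apply _))).real
            {x | s ≤ |(∑ i ∈ Finset.range R, ∑' u, (if (∑ s ∈ Finset.range u,
                  (if (x (s + 1)).2 then (1 : ℕ) else 0)) = i + 1 then (1 : ℝ) else 0) * f (x u).1)
                / (∑ i ∈ Finset.range R, ∑' u, (if (∑ s ∈ Finset.range u,
                  (if (x (s + 1)).2 then (1 : ℕ) else 0)) = i + 1 then (1 : ℝ) else 0))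
                - ∫ V, f V ∂π|}
            ≤ 4 * (Real.exp (-(2 * δ)) * ((∫ V, (f V - ∫ V', f V' ∂π) ^ 2 ∂π)
                + 2 * ∑' k, ∫ V, (f V - ∫ V', f V' ∂π)
                  * (kop (indepMH q w))^[k + 1] (fun V => f V - ∫ V', f V' ∂π) V ∂π)
                / s ^ 2 + (1 - Real.exp (-(2 * δ)))) / R
          ∧ ∀ m : ℕ, 0 < m →
              4 * (Real.exp (-(2 * δ)) * ((∫ V, (f V - ∫ V', f V' ∂π) ^ 2 ∂π)
                + 2 * ∑' k, ∫ V, (f V - ∫ V', f V' ∂π)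
                  * (kop (indepMH q w))^[k + 1] (fun V => f V - ∫ V', f V' ∂π) V ∂π)
                / s ^ 2 + (1 - Real.exp (-(2 * δ)))) / m ≤ 1 / 4 →
              ∀ K : ℕ, (Kernel.trajMeasure
                (X := fun _ : ℕ => GaugeConfig d L (Matrix.specialUnitaryGroup (Fin n) ℂ) × Bool) μs
                (fun j : ℕ => κs.comap (fun y : (i : ↥(Finset.Iic j)) →
                    GaugeConfig d L (Matrix.specialUnitaryGroup (Fin n) ℂ) × Bool =>
                  y ⟨j, Finset.mem_Iic.2 le_rfl⟩) (measurable_pi_apply _))).real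
              {x | (K : ℝ) / 2 ≤ ∑ k ∈ Finset.range K,
                (if s ≤ |(∑ i ∈ Finset.range m, ∑' u, (if (∑ s ∈ Finset.range u,
                      (if (x (s + 1)).2 then (1 : ℕ) else 0)) = k * (m + 1) + i + 1 then (1 : ℝ) else 0)
                      * f (x u).1)
                    / (∑ i ∈ Finset.range m, ∑' u, (if (∑ s ∈ Finset.range u,
                      (if (x (s + 1)).2 then (1 : ℕ) else 0)) = k * (m + 1) + i + 1 then (1 : ℝ) else 0))
                    - ∫ V, f V ∂π| then (1 : ℝ) else 0)}
              ≤ Real.exp (-((K : ℝ) / 8)) := by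
  obtain ⟨w, hw, hwlo, hwhi, hπ, hinv, -, hdoeb⟩ := flowSampler_exact_doeblin B hS hF hΦ hδ q hq
  haveI : Fact (Measurable w) := ⟨hw⟩
  have hS'c : Continuous fun U : GaugeConfig d L (Matrix.specialUnitaryGroup (Fin n) ℂ) =>
      S (WilsonFlow.coeConfig U) := hS.continuous.comp WilsonFlow.continuous_coeConfig
  haveI := isProbabilityMeasure_boltzmannMeasure (d := d) (L := L) hS'c
  have he0 : 0 < Real.exp (-(2 * δ)) := Real.exp_pos _
  have he1 : Real.exp (-(2 * δ)) < 1 := Real.exp_lt_one_iff.2 (by linarith)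
  have hε0 : 0 < ENNReal.ofReal (Real.exp (-(2 * δ))) := ENNReal.ofReal_pos.2 he0
  have hε1 : ENNReal.ofReal (Real.exp (-(2 * δ))) < 1 := by rw [ENNReal.ofReal_lt_one]; exact he1
  have hr : (ENNReal.ofReal (Real.exp (-(2 * δ)))).toReal = Real.exp (-(2 * δ)) :=
    ENNReal.toReal_ofReal he0.le
  have hw0 : ∀ U, 0 < w U := fun U => he0.trans_le (hwlo U)
  have hew : ∀ U, Real.exp (-(2 * δ)) * w U ≤ 1 := fun U => by
    calc Real.exp (-(2 * δ)) * w U ≤ Real.exp (-(2 * δ)) * Real.exp (2 * δ) :=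
          mul_le_mul_of_nonneg_left (hwhi U) he0.le
      _ = 1 := by rw [← Real.exp_add, neg_add_cancel, Real.exp_zero]
  refine ⟨w, hw, fun U _ hA => hdoeb U hA, hπ, hinv, ?_⟩
  obtain ⟨κs, hκsM, hretro, hsplit⟩ := exists_indepMH_retroSupKernel (q := q) hw hw0 hπ he0 he1 hew
    (fun U _ hA => hdoeb U hA)
  refine ⟨κs, hκsM, hretro, hsplit, fun μs _ f hf C hC R hR s hs => ⟨?_, fun m hm hsmall K => ?_⟩⟩
  · have h := regenerative_estimator_confidence_sigma κs μs (κ := indepMH q w)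
      (ν := boltzmannMeasure fun U : GaugeConfig d L (Matrix.specialUnitaryGroup (Fin n) ℂ) =>
        S (WilsonFlow.coeConfig U)) (hmin := fun U _ hA => hdoeb U hA) hinv hε0 hε1 hsplit hf hC hR hs
    rw [hr] at h
    exact h
  · have h := regenerative_medianOfGroups_confidence_sigma κs μs (κ := indepMH q w)
      (ν := boltzmannMeasure fun U : GaugeConfig d L (Matrix.specialUnitaryGroup (Fin n) ℂ) =>
        S (WilsonFlow.coeConfig U)) (hmin := fun U _ hA => hdoeb U hA) hinv hε0 hε1 hsplit hf hC hm
      hs (by rw [hr]; exact hsmall) K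
    exact h

end Summit.Ventures.LatticeQCDFlow.Scoring

end
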